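import Summits.ResolutionOfSingularities.ResolutionOfSingularities.Theorems.HilbertSamuelEliminationSigmaMaxModificationsCorridor3WLadderIsoInsepE2NearLineTower
import Summits.ResolutionOfSingularities.ResolutionOfSingularities.Theorems.HilbertSamuelEliminationSigmaMaxModificationsCorridor3WLadderIsoInsepE2NearResidue
import Mathlib.Algebra.Polynomial.Degree.SmallDegree
import HarnessLib

/-!
# [OURS · L1 W4.2] E2 chart calculus, brick 18b: **THE RC ROW `IsoInsepE2SuccRational₂` PROVED** — in an isolated E3 point tower
# over a maximal origin of characteristic two, the step out of an E2 stage is RATIONAL: `κ(x_n) → κ(x_{n+1})` is onto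
# (crux chain w42, cell k2 `T3insep` = `stub_isoInsepTower`; `--supports stmt-ResolutionOfSingularities-19249`)

OURS (cell res-hironaka, slot W4.2, seat res-D-pv-042; OWN OBJECT TUO 2026-08-27 18:19Z, (N4) of the NJ/RC dictionary); NOT a
statement of [Hironaka2017] nor of [CossartJannsenSaito2020] / [CossartPiltant2008]. AI-drafted, weaker than expert review. PROOF
file, def-free, fact-free.

* `isoInsepE2SuccRational₂_holds : IsoInsepE2SuccRational₂.{0} N` (tree `…IsoInsepTailCutDefs`, the RC row of res-L1-w42-tri-2 r10,
  typed by the cell as an OURS row). Proof: brick 16 (`exists_e2StepPresentation_rational`) presents `𝒪_{X_{n+1},x_{n+1}}` as a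
  quotient of `B_𝔔`, `B = R[𝔪/c_j]`, `𝒪_{X_n,x_n} = R/(h)`, compatibly with `π_n^♯` (clause `hcompat`), with reduction
  `π : B ↠ κ[T]`, `𝔔 = π⁻¹(𝔭)`, `T_k ∈ 𝔭` (`k ≠ kc`), `𝔭 ∩ κ[T_{kc}] = (P)` and **`deg P = 1`**; so `𝔭` contains `T_{kc} − θ`
  (`θ = −b/a` for `P = aT + b`), every element of `B_𝔔` is a constant from `R` modulo `𝔪` (brick 18a
  `exists_sub_algebraMap_mem_maximalIdeal_of_rationalPoint`), and every residue class of `𝒪_{X_{n+1},x_{n+1}}` comes from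
  `𝒪_{X_n,x_n}` through `π_n^♯`: the residue field map is onto.

## References

* V. Cossart, U. Jannsen, S. Saito, LNM 2270 (2020): Def. 2.26, Thm. 3.10 (pointer). [CossartJannsenSaito2020]
-/

noncomputable section

set_option linter.dupNamespace false

open scoped Classical
open CategoryTheory AlgebraicGeometry TopologicalSpace IsLocalRing MvPolynomial
open Literature.RingTheory.HilbertSamuel Literature.AlgebraicGeometry.Resolution Literature.AlgebraicGeometry.CossartJannsenSaito2020
open Summit.ResolutionOfSingularities.ResolutionOfSingularities.Theorems.CampaignW42
open Summit.ResolutionOfSingularities.ResolutionOfSingularities.Theorems.SigmaMaxModificationsCorridor3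
open Summit.ResolutionOfSingularities.ResolutionOfSingularities.Cruxes.SigmaMaxModifications.IdeasL1Idea2R4 (IsIsoPointTower)
open Summit.ResolutionOfSingularities.ResolutionOfSingularities.Cruxes.SigmaMaxModifications.IdeasL1C5 (IsInsepStage IsRationalStep)

namespace Summit.ResolutionOfSingularities.ResolutionOfSingularities.Cruxes.SigmaMaxModifications.IdeasL1C6

/-- **THE RC ROW: THE STEP OUT OF AN E2 STAGE IS RATIONAL.** In an isolated E3 point tower over a maximal origin of characteristic two,
if stage `n` is E2 then `κ(x_n) → κ(x_{n+1})` is onto (`IsRationalStep`): by brick 16 the next point is the `κ(x_n)`-rational point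
`(0, 0, θ)` of the exceptional line, so every element of `B_𝔔` — hence of `𝒪_{X_{n+1},x_{n+1}}` — is a constant from `𝒪_{X_n,x_n}`
modulo the maximal ideal (brick 18a). [OURS · L1 W4.2 · k2 · E2 chart calculus, brick 18b] [folklore] -/
theorem isoInsepE2SuccRational₂_holds (N : ℕ) : IsoInsepE2SuccRational₂.{0} N := by
  intro ν T pt hO hT n hE
  -- brick 16, destructured in pieces (one 60-clause `obtain` is prohibitively slow to elaborate)
  obtain ⟨R, _, _, c, σ, h, cc, lam, hpt, -, -, -, -, -, -, -, -, -, -, hrest⟩ :=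
    exists_e2StepPresentation_rational hO hT n hE
  obtain ⟨j, 𝔔, h', σ', -, -, -, -, -, hreg, hσ', -, hcompat, -, -, -, -, -, -, -, -, -, hrest⟩ := hrest
  obtain ⟨F, -, -, -, -, -, hrest⟩ := hrest
  obtain ⟨π, 𝔭, h𝔭p, kc, P, -, hπalg, -, -, -, hcomap, -, hvars, hP, -, -, -, -, -, hdeg⟩ := hrest
  haveI := h𝔭p
  -- the rational point `(0, 0, θ)`, `θ = -b/a` for `P = aX + b`
  obtain ⟨a, b, hab⟩ := Polynomial.exists_eq_X_add_C_of_natDegree_le_one hdeg.le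
  have ha : a ≠ 0 := by
    rintro rfl
    rw [map_zero, zero_mul, zero_add] at hab
    rw [hab, Polynomial.natDegree_C] at hdeg
    exact zero_ne_one hdeg
  have hPmem : Polynomial.aeval (MvPolynomial.X kc : MvPolynomial {k : Fin 4 // k ≠ j} (ResidueField R)) P ∈ 𝔭 := by
    have : P ∈ 𝔭.comap (Polynomial.aeval (MvPolynomial.X kc : MvPolynomial {k : Fin 4 // k ≠ j} (ResidueField R))) := by
      rw [hP]; exact Ideal.mem_span_singleton_self P
    exact this
  have hXkc : (MvPolynomial.X kc : MvPolynomial {k : Fin 4 // k ≠ j} (ResidueField R)) - C (-b / a) ∈ 𝔭 := by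
    have e : (MvPolynomial.X kc : MvPolynomial {k : Fin 4 // k ≠ j} (ResidueField R)) - C (-b / a) =
        C a⁻¹ * Polynomial.aeval (MvPolynomial.X kc : MvPolynomial {k : Fin 4 // k ≠ j} (ResidueField R)) P := by
      rw [hab, map_add, map_mul, Polynomial.aeval_C, Polynomial.aeval_X, Polynomial.aeval_C, MvPolynomial.algebraMap_eq,
        mul_add, ← mul_assoc, ← map_mul, inv_mul_cancel₀ ha, map_one, one_mul, ← map_mul, sub_eq_add_neg, ← map_neg, neg_div,
        neg_neg, div_eq_inv_mul]
    rw [e]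
    exact 𝔭.mul_mem_left _ hPmem
  have hp : ∀ k : {k : Fin 4 // k ≠ j},
      (MvPolynomial.X k : MvPolynomial {k : Fin 4 // k ≠ j} (ResidueField R)) -
        C ((fun k : {k : Fin 4 // k ≠ j} => if k = kc then -b / a else 0) k) ∈ 𝔭 := by
    intro k
    by_cases hk : k = kc
    · subst hk
      simp only [if_true]
      exact hXkc
    · simp only [if_neg hk, map_zero, sub_zero]
      exact hvars k hk
  -- surjectivity of the residue field map
  show Function.Surjective (IsLocalRing.ResidueField.map ((T.π n).stalkMap (pt (n + 1))).hom)
  haveI hloc : IsLocalHom σ' :=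
    IsLocalHom.of_surjective (R := Localization.AtPrime 𝔔.asIdeal) (S := (T.X (n + 1)).presheaf.stalk (pt (n + 1))) σ' hσ'
  intro w
  obtain ⟨o, rfl⟩ := IsLocalRing.residue_surjective w
  obtain ⟨z, rfl⟩ := hσ' o
  obtain ⟨r, hr⟩ := E2Chart.exists_sub_algebraMap_mem_maximalIdeal_of_rationalPoint π hπalg 𝔔.asIdeal hcomap _ hp z
  refine ⟨IsLocalRing.residue _ (((T.X n).presheaf.stalkCongr (.of_eq hpt)).inv (σ r)), ?_⟩
  rw [IsLocalRing.ResidueField.map_residue, ← hcompat r, eq_comm, ← sub_eq_zero, ← map_sub, IsLocalRing.residue_eq_zero_iff,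
    ← map_sub]
  -- `σ′` is local (surjective), and `z − r/1 ∈ 𝔪_{B_𝔔}`
  have hm := hr
  rw [IsLocalRing.mem_maximalIdeal, mem_nonunits_iff] at hm ⊢
  exact fun hu => hm (IsLocalHom.map_nonunit _ hu)

end Summit.ResolutionOfSingularities.ResolutionOfSingularities.Cruxes.SigmaMaxModifications.IdeasL1C6

end
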